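import Summits.NavierStokesRegularity.NavierStokesRegularity.Theorems.LerayQuarterDissipationRecordTimeTypeITools
import Summits.NavierStokesRegularity.NavierStokesRegularity.Theorems.TypeICertificateLadderRungReynoldsOneTaoCover
import Summits.NavierStokesRegularity.NavierStokesRegularity.Theses.LerayQuarterDissipation
import HarnessLib

/-!
# `LerayQuarterDissipation.RecordTimeTypeI` (item stmt-NavierStokesRegularity-22145): the quarter-rate
# enstrophy law forces the velocity Type-I rate (eI ⇒ vI)

**Statement (the route decl, verbatim).** For a classical Leray–Hopf solution `(u,p)` of the unforced
Navier–Stokes system on `ℝ³ × [0,T)` (`ν, T > 0`) from a rapidly decaying datum: if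
`∫|curl u(t)|² ≤ K/√(T−t)` for all `t ∈ [0,T)`, then `IsTypeIBlowup u T`
(`‖u(t)‖_∞ ≤ C′/√(T−t)` eventually as `t ↑ T`).

PROOF — the item card's RECORD-TIME argument, made junk-free with a running supremum. Let `B₁`
bound `|u|` on `[0,T/2]` (Tao-class cover), `C₀` a KNSS (4.10) gradient constant chosen before the
solution (`exists_uniform_iteratedFDeriv_bound_of_bounded_classical`), `D₀` the record constant of
`RecordTimeTypeI.record_le` and `D = max(2B₁√T, 4√ν, 2D₀)`. If `|u(s,x)| > D/√(T−s)` at some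
`s < T`, let `N` be the supremum of `|u|` over `[0,s] × ℝ³` (finite by the Tao-class cover) and pick
`(σ', y')` there with `|u(σ',y')| > 3N/4`. Then `|u| ≤ N = 2a` on `[0,σ']` with `a = N/2`,
`|u(σ',y')| > 3a/2`, `σ' > T/2` (else `|u(σ',y')| ≤ B₁ ≤ 3D/(4√T)`), and the smoothing window
fits (`8ν/N² ≤ T/2` because `N > 4√(ν/T)`); `record_le` gives `N ≤ 2D₀/√(T−σ') ≤ D/√(T−s) <
|u(s,x)| ≤ N` — contradiction. Hence `|u(t,x)| ≤ D/√(T−t)` on `[0,T)`.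

HONEST FRAMING: a conditional implication (quarter-rate enstrophy law ⇒ velocity Type-I rate) for a
GIVEN classical solution; the quarter law itself (crux `EnstrophyQuarterLaw`, stmt-1574) and the
route's Liouville crux stay open; nothing about NS regularity is asserted. References:
Koch–Nadirashvili–Seregin–Šverák 2009 §4 (4.10); Leray 1934 §20; Evans §5.6.1. [folklore]
-/

noncomputable section

open Set Filter Topology MeasureTheory Metric
open scoped ENNReal NNReal
open Literature.Analysis.FluidPDE

namespace Summit.NavierStokesRegularity.NavierStokesRegularity.Theorems

-- the problem directory repeats the summit name (`NavierStokesRegularity/NavierStokesRegularity`)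
set_option linter.dupNamespace false

namespace RecordTimeTypeI

open Summit.NavierStokesRegularity.NavierStokesRegularity.Theorems.RungReynoldsOne

/-- **The quarter-rate enstrophy law forces the velocity Type-I rate.** [folklore] -/
theorem main {ν T : ℝ} (hν : 0 < ν) (hT : 0 < T) {u : ℝ → (EuclideanSpace ℝ (Fin 3)) → (EuclideanSpace ℝ (Fin 3))} {p : ℝ → (EuclideanSpace ℝ (Fin 3)) → ℝ}
    (hsol : IsClassicalNSSolutionOn (Ico 0 T) ν 0 u p) (hLH : IsLerayHopfOn T ν 0 (u 0) u)
    (hdec : HasRapidSpatialDecay (u 0)) (K : ℝ)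
    (hquarter : ∀ t ∈ Ico 0 T,
      ∫⁻ x, ‖curl (u t) x‖ₑ ^ 2 ≤ ENNReal.ofReal (K / Real.sqrt (T - t))) :
    IsTypeIBlowup u T := by
  -- the KNSS gradient constant, chosen before the solution
  obtain ⟨C, hC⟩ := exists_uniform_iteratedFDeriv_bound_of_bounded_classical 2 2 two_pos
  set C₀ : ℝ := max (C 1 1) 1 with hC₀def
  have hC₀ : 0 < C₀ := lt_of_lt_of_le one_pos (le_max_right _ _)
  have hgrad : ∀ ⦃w : ℝ → (EuclideanSpace ℝ (Fin 3)) → (EuclideanSpace ℝ (Fin 3))⦄ ⦃q : ℝ → (EuclideanSpace ℝ (Fin 3)) → ℝ⦄, IsClassicalNSSolutionOn (Icc 0 2) 1 0 w q →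
      (∃ C : ℝ≥0∞, C < ⊤ ∧ ∀ r ∈ Icc (0 : ℝ) 2, ∫⁻ y, ‖w r y‖ₑ ^ 2 ≤ C) →
      (∀ r ∈ Icc (0 : ℝ) 2, ∀ y, ‖w r y‖ ≤ 2) →
      ∀ r ∈ Ioo (1 : ℝ) 2, ∀ y, ‖fderiv ℝ (w r) y‖ ≤ C₀ := by
    intro w q hw hE hbd r hr y
    have h := hC hw hE two_pos hbd 1 one_pos 1 r hr y
    rw [norm_iteratedFDeriv_one] at h
    exact h.trans (le_max_left _ _)
  -- the sup bound on `[0, T/2]`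
  obtain ⟨q₀, hsol₀, hu₀, -, -⟩ := stub_taoCover hν hT hsol hLH hdec (T' := T / 2)
    ⟨by positivity, by linarith⟩
  obtain ⟨B₁, hB₁0, hB₁⟩ := exists_forall_norm_le_of_hasBoundedSobolevNormsOn hsol₀ hu₀
  -- the constants
  set D₀ : ℝ := 4 * C₀ * (SNormLESNormFDerivOfEqConst (EuclideanSpace ℝ (Fin 3)) (volume : Measure (EuclideanSpace ℝ (Fin 3))) 2 : ℝ) ^ 2 *
    max K 0 / (ν * (volume (ball (0 : (EuclideanSpace ℝ (Fin 3))) 1)).toReal ^ ((1 : ℝ) / 3)) with hD₀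
  have hD₀0 : 0 ≤ D₀ := by
    have : 0 ≤ max K 0 := le_max_right _ _
    positivity
  set D : ℝ := max (max (2 * B₁ * Real.sqrt T) (4 * Real.sqrt ν)) (2 * D₀) with hD
  have hD1 : 2 * B₁ * Real.sqrt T ≤ D := (le_max_left _ _).trans (le_max_left _ _)
  have hD2 : 4 * Real.sqrt ν ≤ D := (le_max_right _ _).trans (le_max_left _ _)
  have hD3 : 2 * D₀ ≤ D := le_max_right _ _
  have hD0 : 0 ≤ D := (by positivity : (0 : ℝ) ≤ 4 * Real.sqrt ν).trans hD2
  have hsT : 0 < Real.sqrt T := Real.sqrt_pos.2 hT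
  -- the claim at every time
  have hall : ∀ s ∈ Ico 0 T, ∀ x, ‖u s x‖ ≤ D / Real.sqrt (T - s) := by
    intro s hs x
    by_contra hcon
    rw [not_le] at hcon
    have hTs : 0 < T - s := sub_pos.2 hs.2
    have hsq : 0 < Real.sqrt (T - s) := Real.sqrt_pos.2 hTs
    have hsqle : Real.sqrt (T - s) ≤ Real.sqrt T := Real.sqrt_le_sqrt (by linarith [hs.1])
    -- `D/√T ≤ D/√(T−s)`
    have hΦ : D / Real.sqrt T ≤ D / Real.sqrt (T - s) := div_le_div_of_nonneg_left hD0 hsq hsqle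
    -- the running supremum over `[0,s] × ℝ³`
    have hs' : (s + T) / 2 ∈ Ioo 0 T := ⟨by linarith [hs.1], by linarith [hs.2]⟩
    obtain ⟨q₁, hsol₁, hu₁, -, -⟩ := stub_taoCover hν hT hsol hLH hdec hs'
    obtain ⟨Bs, -, hBs⟩ := exists_forall_norm_le_of_hasBoundedSobolevNormsOn hsol₁ hu₁
    set S : Set ℝ := (fun z : ℝ × (EuclideanSpace ℝ (Fin 3)) => ‖u z.1 z.2‖) '' (Icc 0 s ×ˢ univ) with hSdef
    have hSne : S.Nonempty := ⟨_, ⟨(s, x), ⟨⟨hs.1, le_rfl⟩, mem_univ _⟩, rfl⟩⟩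
    have hSbdd : BddAbove S := by
      refine ⟨Bs, ?_⟩
      rintro _ ⟨⟨σ, y⟩, ⟨hσ, -⟩, rfl⟩
      exact hBs σ ⟨hσ.1, hσ.2.trans (by linarith [hs.2])⟩ y
    set N : ℝ := sSup S with hNdef
    have hleN : ∀ σ ∈ Icc 0 s, ∀ y, ‖u σ y‖ ≤ N := fun σ hσ y =>
      le_csSup hSbdd ⟨(σ, y), ⟨hσ, mem_univ _⟩, rfl⟩
    have hsxN : ‖u s x‖ ≤ N := hleN s ⟨hs.1, le_rfl⟩ x
    have hNpos : 0 < N := by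
      have : 0 ≤ D / Real.sqrt (T - s) := by positivity
      linarith
    -- a near-record point `(σ', y')`
    obtain ⟨_, ⟨⟨σ', y'⟩, ⟨hσ', -⟩, rfl⟩, hbig⟩ :=
      exists_lt_of_lt_csSup hSne (show 3 * N / 4 < sSup S by rw [← hNdef]; linarith)
    have hbig' : 3 * N / 4 < ‖u σ' y'‖ := hbig
    -- `σ' > T/2`
    have hσ'T : T / 2 < σ' := by
      by_contra h
      rw [not_lt] at h
      have h1 := hB₁ σ' ⟨hσ'.1, h⟩ y'
      have h2 : 2 * B₁ * Real.sqrt T / Real.sqrt T ≤ D / Real.sqrt T :=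
        div_le_div_of_nonneg_right hD1 hsT.le
      rw [mul_div_assoc, div_self hsT.ne', mul_one] at h2
      linarith
    -- the smoothing window fits: `2ν/(N/2)² ≤ σ'`
    have hN4 : 4 * Real.sqrt ν / Real.sqrt T < N := by
      have h2 : 4 * Real.sqrt ν / Real.sqrt T ≤ D / Real.sqrt T :=
        div_le_div_of_nonneg_right hD2 hsT.le
      linarith
    have hwin : 2 * ν / (N / 2) ^ 2 ≤ σ' := by
      have h1 : 0 < 4 * Real.sqrt ν / Real.sqrt T := by positivity
      have h3 : (4 * Real.sqrt ν / Real.sqrt T) ^ 2 < N ^ 2 := by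
        exact pow_lt_pow_left₀ hN4 h1.le two_ne_zero
      have h4 : (4 * Real.sqrt ν / Real.sqrt T) ^ 2 = 16 * ν / T := by
        rw [div_pow, mul_pow, Real.sq_sqrt hν.le, Real.sq_sqrt hT.le]; ring
      rw [h4] at h3
      rw [div_le_iff₀ (by positivity)]
      have h5 : 16 * ν < N ^ 2 * T := by
        have := (div_lt_iff₀ hT).1 h3; linarith
      nlinarith
    -- the record inequality at `σ'` with `a = N/2`
    have hσ'I : σ' ∈ Ioo 0 T := ⟨by linarith, hσ'.2.trans_lt hs.2⟩
    have hbd : ∀ σ ∈ Icc 0 σ', ∀ y, ‖u σ y‖ ≤ 2 * (N / 2) := by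
      intro σ hσ y
      have := hleN σ ⟨hσ.1, hσ.2.trans hσ'.2⟩ y
      linarith
    have hx₀ : 3 * (N / 2) / 2 < ‖u σ' y'‖ := by linarith
    have hrec := record_le hν hsol hLH hquarter hC₀ hgrad hσ'I (by linarith) hwin hbd hx₀
    -- `D₀/√(T−σ') ≤ D₀/√(T−s)` and the contradiction
    have hσs : Real.sqrt (T - s) ≤ Real.sqrt (T - σ') := Real.sqrt_le_sqrt (by linarith [hσ'.2])
    have hmono : D₀ / Real.sqrt (T - σ') ≤ D₀ / Real.sqrt (T - s) :=
      div_le_div_of_nonneg_left hD₀0 hsq hσs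
    have hD3' : 2 * D₀ / Real.sqrt (T - s) ≤ D / Real.sqrt (T - s) :=
      div_le_div_of_nonneg_right hD3 hsq.le
    have : N ≤ 2 * D₀ / Real.sqrt (T - s) := by
      rw [mul_div_assoc]; linarith
    linarith
  exact ⟨D, mem_of_superset (Ico_mem_nhdsLT hT) fun t ht => hall t ht⟩

end RecordTimeTypeI

open RecordTimeTypeI in
/-- **Item stmt-NavierStokesRegularity-22145** (`LerayQuarterDissipation.RecordTimeTypeI`): for a
classical Leray–Hopf rapidly-decaying-datum solution on `[0,T)`, the quarter-rate enstrophy bound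
`∫|curl u(t)|² ≤ K/√(T−t)` on `[0,T)` implies the velocity Type-I rate `IsTypeIBlowup u T`
(record-time capacity argument: KNSS smoothing on the window `[t − 2ν/A², t]` + Sobolev
`Ḣ¹ ⊂ L⁶`). A conditional implication; nothing about NS regularity is asserted. [folklore] -/
theorem lerayQuarterDissipation_recordTimeTypeI_proof :
    Summit.NavierStokesRegularity.NavierStokesRegularity.Theses.LerayQuarterDissipation.RecordTimeTypeI := by
  unfold Summit.NavierStokesRegularity.NavierStokesRegularity.Theses.LerayQuarterDissipation.RecordTimeTypeI
  intro ν T hν hT u p hsol hLH hdec K hK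
  exact main hν hT hsol hLH hdec K hK

end Summit.NavierStokesRegularity.NavierStokesRegularity.Theorems

end
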